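import Summits.BirchSwinnertonDyer.BirchSwinnertonDyer.Theorems.ClassRecordThreeLambdaMatchingTransferRational
import Summits.BirchSwinnertonDyer.BirchSwinnertonDyer.Theorems.UniversalToricDescentBDPFrameCrossPeriodRigidity
import Summits.BirchSwinnertonDyer.BirchSwinnertonDyer.Theorems.SchneiderFreeAdditiveX3GordTwoBranchIMCDivOfKY
import Summits.BirchSwinnertonDyer.Rank1Residual.Partition.IrreducibleOverQuadraticField
import Summits.BirchSwinnertonDyer.Rank1Residual.X11b.Three.StepLHalves
import Literature.NumberTheory.EllipticCurves.YanZhu2026.AnticyclotomicMainTheorems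
import Literature.NumberTheory.EllipticCurves.BurungaleCastellaSkinner2025.BDPMainConjecture
import Literature.NumberTheory.EllipticCurves.PAdicGrossZagierConstantTermProofs
import HarnessLib

/-!
# ROAD B12 @3, the registered INV₃ stub of crux `IMCDivTwoLociAtThreeR` (item 20262; KOLY twin 20263) FROM ITS
# SOURCES, BY NAME: Yan–Zhu 2026 Thm 5.7 (1) RATIONAL clause (tree fact) for a good-ordinary Heegner PARTNER +
# the INTEGRAL Euler-side divisibility UB₃♯ for E + the partner-transfer data TRANSFER₃ (analytic congruence and
# residual μ∕λ transfer); hence items 20262 ∕ 20263 ⟸ {thm57, prop422 (PRINT), UB₃♯, TRANSFER₃}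

Cell `bsd-stepL` (run/shared/lean/pub/bsd-stepL/), seat `bsd-stepL-bdp` (prover g23, 2026-08-27). `--supports
stmt-BirchSwinnertonDyer-20262 --as helper`. THEOREMS ONLY (no definition, no named fact, no `sorry`). Memo:
HOME/proof/PROOF-BDP.md §57 (57.1 chain, 57.3 K-uniform rational partners at 3: 188 ∕ 512 finite-flat TRUE-OPEN
classes, certificates 57.8, 57.5 kernel p551362).

THE REGISTERED LINE (`Cruxes/IMCDivTwoLociAtThreeR/Lines/lambdaMatching.lean`): stubs UB₃ (`∃ k, 3^k·L ∈ Ch·R₀⟦T⟧`)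
and INV₃ (`∃ g n, Ch = (g) ∧ FU(map g, n) ∧ FU(L, n)`), composition p505319. THIS FILE derives INV₃ — signature
VERBATIM — from four hypotheses over the SAME binders:
* `h57 : YanZhu2026.thm57_isTorsion_charIdealXGr_eq_bdpLFunction` — the PRINT anchor (J. Algebra 693 (2026)
  Thm 5.7 (1)), consumed through its RATIONAL clause only (no full-`3`-adic-image hypothesis on the partner: the
  memo's port π4 is gone);
* `h422 : BurungaleCastellaSkinner2025.prop422_exists_isBDPLFunction_mu_eq_zero` — PRINT (`μ(L_p^BDP) = 0` for the
  good partner, IMRN 2025 Prop 4.2.2 after Hsieh 2014 Thm B; `2 < p` allows `p = 3`);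
* UB₃♯ — UB₃ with `k = 0`: `L ∈ Ch_Λ(X_ac 𝔭bar)·R₀⟦T⟧` (PROOF-BDP §55 THEOREM UB, refereed g44–g54; implies UB₃);
* TRANSFER₃ — for each datum: a PARTNER `W′` (good ordinary at 3, `ρ̄_{W′,3}` onto, Heegner for the SAME `K` at
  its level `N′`) such that for all generators `g, g′` of the two characteristic ideals at `𝔭bar` and every BDP
  frame `L′` of `W′` at `(ι′, 𝔭)`: Σ-factors `P, P′` with `μ = 0`, a unit `u`, the ANALYTIC CONGRUENCE
  `u·L′·P′ ≡ L·P (mod 𝔪)` (PROOF-BDP §40), the residual `μ`-TRANSFER and the residual `λ`-EQUALITY (PROOF-BDP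
  §37.11) — i.e. exactly bricks (ε4) + (ε2) of §37.2; on the 188 classes of §57.3 the partner is a RATIONAL curve
  of conductor supported on `supp(N) ∖ {3}` (so Heegner for every `K` of the datum), certified (kit j285719).
This file (PART A, Theses-free): `inv3_of_thm57_of_upperDivisibility_of_transfer` (INV₃ verbatim) and
`ub3_of_upperDivisibility` (UB₃ verbatim from UB₃♯). PART B (`…FromThm57TransferByName.lean`, route-coned)
concludes items 20262 ∕ 20263 BY NAME from the same four hypotheses via p505319.

HONEST FRAMING: CONDITIONAL theorems; UB₃♯ and TRANSFER₃ are OPEN typed shapes (memo-proved: §55 resp. §40 ∕ §37.11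
+ the certified partner census §57.3∕57.8 — on 188 of the 512 finite-flat TRUE-OPEN classes; NO partner exists off
the finite-flat locus); `h57` is a named PRINT fact carried by name (flag `YZ26@3-BF-ERL-Ohta`); nothing is
discharged, booked or re-labelled (T7); O2 stays OPEN; BSD(E,3) is proved for no class.

References: [YanZhu2024MainConjNonCM] Thm. 5.7 (1); [Washington1997] §7.1 Prop. 7.2, §13.2; [EmertonPollackWeston2006]
Thm. 1; [GreenbergVatsal2000] Prop. 2.4; PROOF-BDP §37, §40, §55, §57.
-/

set_option autoImplicit false
set_option linter.dupNamespace false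

noncomputable section

open scoped Classical

open WeierstrassCurve NumberField IsDedekindDomain Field PowerSeries
  Literature.NumberTheory.EllipticCurves Literature.NumberTheory.EllipticCurves.ModularForms
  Literature.NumberTheory.EllipticCurves.Rank1Residual
  Literature.NumberTheory.GaloisRepresentations
  Summit.BirchSwinnertonDyer.Rank1Residual Summit.BirchSwinnertonDyer.Rank1Residual.X11b
  Summit.BirchSwinnertonDyer.Rank1Residual.X11b.AcSelmer
  Summit.BirchSwinnertonDyer.Rank1Residual.X11b.CongruenceLimit
  Summit.BirchSwinnertonDyer.Rank1Residual.X11b.Halves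
  Summit.BirchSwinnertonDyer.Rank1Residual.X11b.Three
  Summit.BirchSwinnertonDyer.Rank1Residual.X1.KellerYinHalves
  Summit.BirchSwinnertonDyer.BirchSwinnertonDyer.Theorems.LambdaMatching
  Summit.BirchSwinnertonDyer.BirchSwinnertonDyer.Theorems.UniversalToricDescentTwinSplit
  Summit.BirchSwinnertonDyer.BirchSwinnertonDyer.Theorems.SchneiderFree

namespace Summit.BirchSwinnertonDyer.BirchSwinnertonDyer.Theorems.LambdaMatchingAtThree

/-- **INV₃ (signature VERBATIM) ⟸ {Yan–Zhu 5.7 (1), UB₃♯, TRANSFER₃}.** At each datum: pick a generator `g` of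
`Ch_Λ(X_ac(E) 𝔭bar)` and `g′` of the partner's; Yan–Zhu 5.7 (1) (rational clause, at the partner's own frame `L₀`,
which exists by the same fact) gives `3^k L₀ ∈ (map g′)` and `3^{k′} map g′ ∈ (L₀)`; TRANSFER₃ at `(g, g′, L₀)` and
UB₃♯ feed `LambdaMatching.invariantsMatch_of_transfer_rational` (p551362), which returns FU(map g, n) ∧ FU(L, n).
CONDITIONAL; nothing booked. [cite: YanZhu2024MainConjNonCM, Thm. 5.7 (1) (§5.2, arXiv:2412.20078v4 l.1217–1227)]
[cite: Washington1997, §7.1 Prop. 7.2 and §13.2] [cite: EmertonPollackWeston2006, Thm. 1 (the mechanism)] -/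
theorem inv3_of_thm57_of_upperDivisibility_of_transfer
    (h57 : YanZhu2026.thm57_isTorsion_charIdealXGr_eq_bdpLFunction)
    (h422 : BurungaleCastellaSkinner2025.prop422_exists_isBDPLFunction_mu_eq_zero)
    (hUB : ∀ (W : WeierstrassCurve ℚ) [W.IsElliptic] [W.IsGloballyMinimal],
      ClassX11b W 3 → Surj W 3 → (Ram W 3 → W.HasSplitMultiplicativeReductionAtPrime 3) →
      ∀ (N : ℕ) [NeZero N] (K : Type) [Field K] [NumberField K] (Dt : ModularParametrizationData W N)
      (H : HeegnerDatum N (NumberField.discr K)) (ι : K →+* ℂ) (P : (W.baseChange K).toAffine.Point),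
      ClassX11b W 3 → Surj W 3 → W.conductorNorm ℤ = N → IsImaginaryQuadratic K →
      Odd (NumberField.discr K) → SatisfiesHeegnerHypothesis N K →
      (W.quadraticTwist (NumberField.discr K : ℚ)).entireLFunction 1 ≠ 0 →
      WeierstrassCurve.Affine.Point.map ι.toRatAlgHom P = heegnerPointComplex Dt H →
      ¬ (3 : ℤ) ∣ Dt.c → ¬ IsOfFinAddOrder P →
      ∀ (κ : ZpExtension K 3), κ.IsAnticyclotomic →
        ∀ (γ : Field.absoluteGaloisGroup K) [Fact (κ.IsTopGenerator γ)]
          (𝔭 : HeightOneSpectrum (𝓞 K)), ((3 : ℕ) : 𝓞 K) ∈ 𝔭.asIdeal →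
          𝔭.asIdeal.ramificationIdx (𝓞 ℚ) = 1 → 𝔭.asIdeal.inertiaDeg (𝓞 ℚ) = 1 →
          ∀ (f : CuspForm (CongruenceSubgroup.Gamma0 N) 2), IsNewformOf W f →
            ∀ (ι' : PadicAlgCl 3 ≃+* ℂ), InducesPrime ι' 𝔭 →
              ∀ (ΩK : ℂ) (Ωp : (unrIntegers 3)ˣ) (L : UnrSeries 3), ΩK ≠ 0 →
                IsBDPLFunction ι' 𝔭 κ γ f ΩK ((Ωp : unrIntegers 3) : ℂ_[3]) L →
                  ∀ (𝔭bar : HeightOneSpectrum (𝓞 K)), ((3 : ℕ) : 𝓞 K) ∈ 𝔭bar.asIdeal → 𝔭bar ≠ 𝔭 →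
                    L ∈ (XAc.charIdeal (W.baseChange K) 3 κ 𝔭bar ∅ γ).map (PowerSeries.map (toUnr 3)))
    (hTR : ∀ (W : WeierstrassCurve ℚ) [W.IsElliptic] [W.IsGloballyMinimal],
      ClassX11b W 3 → Surj W 3 → (Ram W 3 → W.HasSplitMultiplicativeReductionAtPrime 3) →
      ∀ (N : ℕ) [NeZero N] (K : Type) [Field K] [NumberField K] (Dt : ModularParametrizationData W N)
      (H : HeegnerDatum N (NumberField.discr K)) (ι : K →+* ℂ) (P : (W.baseChange K).toAffine.Point),
      ClassX11b W 3 → Surj W 3 → W.conductorNorm ℤ = N → IsImaginaryQuadratic K →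
      Odd (NumberField.discr K) → SatisfiesHeegnerHypothesis N K →
      (W.quadraticTwist (NumberField.discr K : ℚ)).entireLFunction 1 ≠ 0 →
      WeierstrassCurve.Affine.Point.map ι.toRatAlgHom P = heegnerPointComplex Dt H →
      ¬ (3 : ℤ) ∣ Dt.c → ¬ IsOfFinAddOrder P →
      ∀ (κ : ZpExtension K 3), κ.IsAnticyclotomic →
        ∀ (γ : Field.absoluteGaloisGroup K) [Fact (κ.IsTopGenerator γ)]
          (𝔭 : HeightOneSpectrum (𝓞 K)), ((3 : ℕ) : 𝓞 K) ∈ 𝔭.asIdeal →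
          𝔭.asIdeal.ramificationIdx (𝓞 ℚ) = 1 → 𝔭.asIdeal.inertiaDeg (𝓞 ℚ) = 1 →
          ∀ (f : CuspForm (CongruenceSubgroup.Gamma0 N) 2), IsNewformOf W f →
            ∀ (ι' : PadicAlgCl 3 ≃+* ℂ), InducesPrime ι' 𝔭 →
              ∀ (ΩK : ℂ) (Ωp : (unrIntegers 3)ˣ) (L : UnrSeries 3), ΩK ≠ 0 →
                IsBDPLFunction ι' 𝔭 κ γ f ΩK ((Ωp : unrIntegers 3) : ℂ_[3]) L →
                  ∀ (𝔭bar : HeightOneSpectrum (𝓞 K)), ((3 : ℕ) : 𝓞 K) ∈ 𝔭bar.asIdeal → 𝔭bar ≠ 𝔭 →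
                    ∃ (W' : WeierstrassCurve ℚ) (_ : W'.IsElliptic) (_ : W'.IsGloballyMinimal) (N' : ℕ)
                      (_ : NeZero N') (Dt' : ModularParametrizationData W' N'),
                      GoodOrd W' 3 ∧ Surj W' 3 ∧ SatisfiesHeegnerHypothesis N' K ∧
                      ∀ (g g' : IwasawaAlgebra 3),
                        XAc.charIdeal (W.baseChange K) 3 κ 𝔭bar ∅ γ = Ideal.span {g} →
                        XAc.charIdeal (W'.baseChange K) 3 κ 𝔭bar ∅ γ = Ideal.span {g'} →
                        ∀ (ΩK' : ℂ) (Ωp' : (unrIntegers 3)ˣ) (L' : UnrSeries 3), ΩK' ≠ 0 →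
                          IsBDPLFunction ι' 𝔭 κ γ Dt'.f ΩK' ((Ωp' : unrIntegers 3) : ℂ_[3]) L' →
                          ∃ (P P' u : UnrSeries 3) (m m' : ℕ),
                            (‖((coeff m (P) : unrIntegers 3) : ℂ_[3])‖ = 1 ∧
                              ∀ i < m, ‖((coeff i (P) : unrIntegers 3) : ℂ_[3])‖ < 1) ∧
                            (‖((coeff m' (P') : unrIntegers 3) : ℂ_[3])‖ = 1 ∧
                              ∀ i < m', ‖((coeff i (P') : unrIntegers 3) : ℂ_[3])‖ < 1) ∧
                            IsUnit u ∧
                            (∀ i, ‖((coeff i (u * (L' * P')) : unrIntegers 3) : ℂ_[3]) -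
                              ((coeff i (L * P) : unrIntegers 3) : ℂ_[3])‖ < 1) ∧
                            ((∃ a, (‖((coeff a (PowerSeries.map (toUnr 3) g * P) : unrIntegers 3) : ℂ_[3])‖ = 1 ∧
                                ∀ i < a, ‖((coeff i (PowerSeries.map (toUnr 3) g * P) : unrIntegers 3) : ℂ_[3])‖ < 1)) →
                              ∃ a', (‖((coeff a' (PowerSeries.map (toUnr 3) g' * P') : unrIntegers 3) : ℂ_[3])‖ = 1 ∧
                                ∀ i < a', ‖((coeff i (PowerSeries.map (toUnr 3) g' * P') : unrIntegers 3) : ℂ_[3])‖ < 1)) ∧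
                            (∀ a a', (‖((coeff a (PowerSeries.map (toUnr 3) g * P) : unrIntegers 3) : ℂ_[3])‖ = 1 ∧
                                ∀ i < a, ‖((coeff i (PowerSeries.map (toUnr 3) g * P) : unrIntegers 3) : ℂ_[3])‖ < 1) →
                              (‖((coeff a' (PowerSeries.map (toUnr 3) g' * P') : unrIntegers 3) : ℂ_[3])‖ = 1 ∧
                                ∀ i < a', ‖((coeff i (PowerSeries.map (toUnr 3) g' * P') : unrIntegers 3) : ℂ_[3])‖ < 1) → a = a')) :
    ∀ (W : WeierstrassCurve ℚ) [W.IsElliptic] [W.IsGloballyMinimal],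
      ClassX11b W 3 → Surj W 3 → (Ram W 3 → W.HasSplitMultiplicativeReductionAtPrime 3) →
      ∀ (N : ℕ) [NeZero N] (K : Type) [Field K] [NumberField K] (Dt : ModularParametrizationData W N)
      (H : HeegnerDatum N (NumberField.discr K)) (ι : K →+* ℂ) (P : (W.baseChange K).toAffine.Point),
      ClassX11b W 3 → Surj W 3 → W.conductorNorm ℤ = N → IsImaginaryQuadratic K →
      Odd (NumberField.discr K) → SatisfiesHeegnerHypothesis N K →
      (W.quadraticTwist (NumberField.discr K : ℚ)).entireLFunction 1 ≠ 0 →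
      WeierstrassCurve.Affine.Point.map ι.toRatAlgHom P = heegnerPointComplex Dt H →
      ¬ (3 : ℤ) ∣ Dt.c → ¬ IsOfFinAddOrder P →
      ∀ (κ : ZpExtension K 3), κ.IsAnticyclotomic →
        ∀ (γ : Field.absoluteGaloisGroup K) [Fact (κ.IsTopGenerator γ)]
          (𝔭 : HeightOneSpectrum (𝓞 K)), ((3 : ℕ) : 𝓞 K) ∈ 𝔭.asIdeal →
          𝔭.asIdeal.ramificationIdx (𝓞 ℚ) = 1 → 𝔭.asIdeal.inertiaDeg (𝓞 ℚ) = 1 →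
          ∀ (f : CuspForm (CongruenceSubgroup.Gamma0 N) 2), IsNewformOf W f →
            ∀ (ι' : PadicAlgCl 3 ≃+* ℂ), InducesPrime ι' 𝔭 →
              ∀ (ΩK : ℂ) (Ωp : (unrIntegers 3)ˣ) (L : UnrSeries 3), ΩK ≠ 0 →
                IsBDPLFunction ι' 𝔭 κ γ f ΩK ((Ωp : unrIntegers 3) : ℂ_[3]) L →
                  ∀ (𝔭bar : HeightOneSpectrum (𝓞 K)), ((3 : ℕ) : 𝓞 K) ∈ 𝔭bar.asIdeal → 𝔭bar ≠ 𝔭 →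
                    ∃ (g : IwasawaAlgebra 3) (n : ℕ),
                      XAc.charIdeal (W.baseChange K) 3 κ 𝔭bar ∅ γ = Ideal.span {g} ∧
                      (‖((coeff n (PowerSeries.map (toUnr 3) g) : unrIntegers 3) : ℂ_[3])‖ = 1 ∧
                        ∀ i < n, ‖((coeff i (PowerSeries.map (toUnr 3) g) : unrIntegers 3) : ℂ_[3])‖ < 1) ∧
                      (‖((coeff n L : unrIntegers 3) : ℂ_[3])‖ = 1 ∧
                        ∀ i < n, ‖((coeff i L : unrIntegers 3) : ℂ_[3])‖ < 1) := by
  intro W _ _ hX hsurj hloc N _ K _ _ Dt H ι P hX' hsurj' hN hK hodd hheeg hL1 hP hc hP0 κ hκ γ _ 𝔭 h𝔭 he hf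
    f hfW ι' hι' ΩK Ωp L hΩK hL 𝔭bar h𝔭bar hne
  -- the partner and its transfer data
  obtain ⟨W', hE', hGM', N', hN', Dt', hord, hsurjW', hH', htr⟩ := hTR W hX hsurj hloc N K Dt H ι P hX' hsurj' hN
    hK hodd hheeg hL1 hP hc hP0 κ hκ γ 𝔭 h𝔭 he hf f hfW ι' hι' ΩK Ωp L hΩK hL 𝔭bar h𝔭bar hne
  -- generators of the two characteristic ideals
  obtain ⟨g, hg⟩ : ∃ g : IwasawaAlgebra 3, XAc.charIdeal (W.baseChange K) 3 κ 𝔭bar ∅ γ = Ideal.span {g} :=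
    (charIdeal_isPrincipal_holds 3 _).principal
  obtain ⟨g', hg'⟩ : ∃ g' : IwasawaAlgebra 3, XAc.charIdeal (W'.baseChange K) 3 κ 𝔭bar ∅ γ = Ideal.span {g'} :=
    (charIdeal_isPrincipal_holds 3 _).principal
  -- Yan–Zhu 5.7 (1) for the partner: a frame `L₀` and the RATIONAL equality along `toUnr 3`
  have h2 : Module.finrank ℚ K = 2 := hK.1
  have hspl : ((Ideal.span {((3 : ℕ) : ℤ)}).primesOver (𝓞 K)).ncard = 2 :=
    ncard_primesOver_eq_two_of_degreeOne h2 h𝔭 he hf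
  have hirrK : (W'.baseChange K).HasIrreducibleModPGaloisRep 3 := irrK_of_surj W' 3 hsurjW' K h2
  have hd3 : NumberField.discr K ≠ -3 := by
    have hnd : ¬ ((3 : ℕ) : ℤ) ∣ NumberField.discr K :=
      not_dvd_discr_of_ncard_primesOver Nat.prime_three (hspl.trans h2.symm)
    intro h
    exact hnd ⟨-1, by rw [h]; norm_num⟩
  obtain ⟨ΩK₀, Ωp₀, L₀, hΩK₀, hL₀, -, hdiv⟩ :=
    h57 ι' W' K 𝔭 𝔭bar κ γ Dt'.isNewformOf le_rfl hord hirrK hK hH' hspl hodd hd3 hι' h𝔭bar hne hκ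
  obtain ⟨⟨k, hk⟩, ⟨k', hk'⟩⟩ := (hdiv (toUnr 3) (coe_toUnr 3)).1
  have hbr : (XAc.charIdeal (W'.baseChange K) 3 κ 𝔭bar ∅ γ).map (PowerSeries.map (toUnr 3)) =
      Ideal.span {PowerSeries.map (toUnr 3) g'} := by rw [hg', Ideal.map_span, Set.image_singleton]
  have hbr' : (Literature.NumberTheory.EllipticCurves.Castella2018.AcSelmer.XAc.charIdeal (W'.baseChange K) 3 κ
      𝔭bar ∅ γ).map (PowerSeries.map (toUnr 3)) = Ideal.span {PowerSeries.map (toUnr 3) g'} := by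
    rw [← xac_charIdeal_eq_literature]; exact hbr
  have hanc : C (((3 : ℕ) : unrIntegers 3) ^ k) * L₀ ∈
      Ideal.span ({PowerSeries.map (toUnr 3) g'} : Set (UnrSeries 3)) := by rw [← hbr']; exact hk
  have hanc' : C (((3 : ℕ) : unrIntegers 3) ^ k') * PowerSeries.map (toUnr 3) g' ∈
      Ideal.span ({L₀} : Set (UnrSeries 3)) :=
    hk' _ (by rw [hbr']; exact Ideal.mem_span_singleton_self _)
  -- the transfer data at `(g, g′, L₀)` and UB₃♯ at the datum
  obtain ⟨P₁, P', u, m, m', hP₁, hP', hu, hcong, hμ, hlam⟩ := htr g g' hg hg' ΩK₀ Ωp₀ L₀ hΩK₀ hL₀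
  have hUB' : L ∈ Ideal.span ({PowerSeries.map (toUnr 3) g} : Set (UnrSeries 3)) := by
    have h := hUB W hX hsurj hloc N K Dt H ι P hX' hsurj' hN hK hodd hheeg hL1 hP hc hP0 κ hκ γ 𝔭 h𝔭 he hf f hfW
      ι' hι' ΩK Ωp L hΩK hL 𝔭bar h𝔭bar hne
    rwa [hg, Ideal.map_span, Set.image_singleton] at h
  -- μ(L₀) = 0: BCS25 Prop. 4.2.2 (Hsieh 2014 Thm. B) gives SOME frame `L₁` of the partner with a unit
  -- coefficient; the two frames generate the same ideal (cross-period rigidity), so `L₀` has one too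
  obtain ⟨ΩK₁, Ωp₁, L₁, hΩK₁, hL₁, k₁, hk₁⟩ :=
    h422 ι' W' K 𝔭 κ γ Dt'.isNewformOf (by norm_num) hord.1 hK hH' hspl hodd hd3 hirrK h𝔭 hι' hκ Fact.out
  have hΩp₀ : ((Ωp₀ : unrIntegers 3) : ℂ_[3]) ≠ 0 := by
    intro h0
    have h1 := norm_coe_units_unrIntegers 3 Ωp₀
    rw [h0, norm_zero] at h1
    exact zero_ne_one h1
  have hΩp₁ : ((Ωp₁ : unrIntegers 3) : ℂ_[3]) ≠ 0 := by
    intro h0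
    have h1 := norm_coe_units_unrIntegers 3 Ωp₁
    rw [h0, norm_zero] at h1
    exact zero_ne_one h1
  have hspan : Ideal.span ({L₀} : Set (UnrSeries 3)) = Ideal.span {L₁} :=
    span_singleton_eq_of_isBDPLFunction hK hκ Fact.out hΩK₁ hΩK₀ hΩp₁ hΩp₀ hL₁ hL₀
  have hL₁FU : ∃ b ≤ k₁, (‖((coeff b L₁ : unrIntegers 3) : ℂ_[3])‖ = 1 ∧
      ∀ i < b, ‖((coeff i L₁ : unrIntegers 3) : ℂ_[3])‖ < 1) :=
    exists_firstUnitCoeffAt_of_exists_le ⟨k₁, le_rfl, by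
      rw [(unrIntegers.isUnit_iff_norm_eq_one _).mp hk₁]; exact lt_irrefl _⟩
  obtain ⟨b, -, hL₁b⟩ := hL₁FU
  have hL₀b := firstUnitCoeffAt_of_span_singleton_eq hspan hL₁b
  obtain ⟨⟨n, hgn, hLn⟩, -⟩ := invariantsMatch_of_transfer_rational hanc hanc' hL₀b hP₁ hP' hu hcong hUB' hμ hlam
  exact ⟨g, n, hg, hgn, hLn⟩

/-- **UB₃ (signature VERBATIM, the registered `stub_ub3_ratUpperDivisibility` shape) ⟸ UB₃♯** (`k := 0`).
[cite: Washington1997, §13.2] -/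
theorem ub3_of_upperDivisibility
    (hUB : ∀ (W : WeierstrassCurve ℚ) [W.IsElliptic] [W.IsGloballyMinimal],
      ClassX11b W 3 → Surj W 3 → (Ram W 3 → W.HasSplitMultiplicativeReductionAtPrime 3) →
      ∀ (N : ℕ) [NeZero N] (K : Type) [Field K] [NumberField K] (Dt : ModularParametrizationData W N)
      (H : HeegnerDatum N (NumberField.discr K)) (ι : K →+* ℂ) (P : (W.baseChange K).toAffine.Point),
      ClassX11b W 3 → Surj W 3 → W.conductorNorm ℤ = N → IsImaginaryQuadratic K →
      Odd (NumberField.discr K) → SatisfiesHeegnerHypothesis N K →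
      (W.quadraticTwist (NumberField.discr K : ℚ)).entireLFunction 1 ≠ 0 →
      WeierstrassCurve.Affine.Point.map ι.toRatAlgHom P = heegnerPointComplex Dt H →
      ¬ (3 : ℤ) ∣ Dt.c → ¬ IsOfFinAddOrder P →
      ∀ (κ : ZpExtension K 3), κ.IsAnticyclotomic →
        ∀ (γ : Field.absoluteGaloisGroup K) [Fact (κ.IsTopGenerator γ)]
          (𝔭 : HeightOneSpectrum (𝓞 K)), ((3 : ℕ) : 𝓞 K) ∈ 𝔭.asIdeal →
          𝔭.asIdeal.ramificationIdx (𝓞 ℚ) = 1 → 𝔭.asIdeal.inertiaDeg (𝓞 ℚ) = 1 →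
          ∀ (f : CuspForm (CongruenceSubgroup.Gamma0 N) 2), IsNewformOf W f →
            ∀ (ι' : PadicAlgCl 3 ≃+* ℂ), InducesPrime ι' 𝔭 →
              ∀ (ΩK : ℂ) (Ωp : (unrIntegers 3)ˣ) (L : UnrSeries 3), ΩK ≠ 0 →
                IsBDPLFunction ι' 𝔭 κ γ f ΩK ((Ωp : unrIntegers 3) : ℂ_[3]) L →
                  ∀ (𝔭bar : HeightOneSpectrum (𝓞 K)), ((3 : ℕ) : 𝓞 K) ∈ 𝔭bar.asIdeal → 𝔭bar ≠ 𝔭 →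
                    L ∈ (XAc.charIdeal (W.baseChange K) 3 κ 𝔭bar ∅ γ).map (PowerSeries.map (toUnr 3))) :
    ∀ (W : WeierstrassCurve ℚ) [W.IsElliptic] [W.IsGloballyMinimal],
      ClassX11b W 3 → Surj W 3 → (Ram W 3 → W.HasSplitMultiplicativeReductionAtPrime 3) →
      ∀ (N : ℕ) [NeZero N] (K : Type) [Field K] [NumberField K] (Dt : ModularParametrizationData W N)
      (H : HeegnerDatum N (NumberField.discr K)) (ι : K →+* ℂ) (P : (W.baseChange K).toAffine.Point),
      ClassX11b W 3 → Surj W 3 → W.conductorNorm ℤ = N → IsImaginaryQuadratic K →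
      Odd (NumberField.discr K) → SatisfiesHeegnerHypothesis N K →
      (W.quadraticTwist (NumberField.discr K : ℚ)).entireLFunction 1 ≠ 0 →
      WeierstrassCurve.Affine.Point.map ι.toRatAlgHom P = heegnerPointComplex Dt H →
      ¬ (3 : ℤ) ∣ Dt.c → ¬ IsOfFinAddOrder P →
      ∀ (κ : ZpExtension K 3), κ.IsAnticyclotomic →
        ∀ (γ : Field.absoluteGaloisGroup K) [Fact (κ.IsTopGenerator γ)]
          (𝔭 : HeightOneSpectrum (𝓞 K)), ((3 : ℕ) : 𝓞 K) ∈ 𝔭.asIdeal →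
          𝔭.asIdeal.ramificationIdx (𝓞 ℚ) = 1 → 𝔭.asIdeal.inertiaDeg (𝓞 ℚ) = 1 →
          ∀ (f : CuspForm (CongruenceSubgroup.Gamma0 N) 2), IsNewformOf W f →
            ∀ (ι' : PadicAlgCl 3 ≃+* ℂ), InducesPrime ι' 𝔭 →
              ∀ (ΩK : ℂ) (Ωp : (unrIntegers 3)ˣ) (L : UnrSeries 3), ΩK ≠ 0 →
                IsBDPLFunction ι' 𝔭 κ γ f ΩK ((Ωp : unrIntegers 3) : ℂ_[3]) L →
                  ∀ (𝔭bar : HeightOneSpectrum (𝓞 K)), ((3 : ℕ) : 𝓞 K) ∈ 𝔭bar.asIdeal → 𝔭bar ≠ 𝔭 →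
                    ∃ k : ℕ, C (((3 : ℕ) : unrIntegers 3) ^ k) * L ∈
                      (XAc.charIdeal (W.baseChange K) 3 κ 𝔭bar ∅ γ).map (PowerSeries.map (toUnr 3)) := by
  intro W _ _ hX hsurj hloc N _ K _ _ Dt H ι P hX' hsurj' hN hK hodd hheeg hL1 hP hc hP0 κ hκ γ _ 𝔭 h𝔭 he hf
    f hfW ι' hι' ΩK Ωp L hΩK hL 𝔭bar h𝔭bar hne
  refine ⟨0, ?_⟩
  rw [pow_zero, map_one, one_mul]
  exact hUB W hX hsurj hloc N K Dt H ι P hX' hsurj' hN hK hodd hheeg hL1 hP hc hP0 κ hκ γ 𝔭 h𝔭 he hf f hfW ι' hι'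
    ΩK Ωp L hΩK hL 𝔭bar h𝔭bar hne

end Summit.BirchSwinnertonDyer.BirchSwinnertonDyer.Theorems.LambdaMatchingAtThree

end
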